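import Mathlib

/-!
# The normalizer-grid law: a four-point obstruction to level-one separation
# (crux `LevelGradedCohnUmans.GradedDesignFamily`, stmt-MatrixMultiplication-7610; negative side,
# line `quadratic-extension-level-one-cell`, lead c6)

Level-one ("frame") test functions on a group `G` acting on a finite set `V` are the functions
`g ↦ Σ_u C u (g • u)`.  Let `H ≤ G` be a finite subgroup, `λ ∈ G` commuting with `H` and with an
element `d` normalising `H`, and suppose the DICHOTOMY: every `v ∈ V` is moved by `λ` inside its
`H`-orbit or is moved by `d` inside its `H`-orbit (`∃ h ∈ H, h • v = λ • v` or `∃ h ∈ H, h • v = d • v`).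
Then for every frame function `F` and every `g`,

* `sum_frame_grid_eq_zero` — `Σ_{h ∈ H} (F(h g) − F(h λ g) − F(h d g) + F(h λ d g)) = 0`:

the four cosets `Hg, Hλg, Hdg, Hλdg` (a "rectangle" of the grid `N_G(H)g/H`) carry a signed measure
all of whose level-one X-rays vanish.  Consequently

* `not_frameSeparated_of_grid_triple` — if `(H, Y, Z)` is separated in the sense of the route by a
  test space `J` consisting of frame functions, then for NO target `z₀ ∈ Z` can the three cosets
  `Hλz₀, Hdz₀, Hλdz₀` all lie among the non-target footprint words `x⁻¹ y y'⁻¹ z`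
  (`x ∈ H`, `¬(x = 1 ∧ y = y' ∧ z = z₀)`): summing the separator of the target `(1, z₀)` over the
  rectangle gives `1 = 0`.

In the level-one subfield cell (`G = GL₂(𝔽_{q²})`, `V = 𝔽_{q²}²`, `H = SL₂(𝔽_q) = SU₂(q)`) the
hypotheses hold for every norm-one scalar `λ` (it acts on each non-isotropic vector like an element of
`H`, namely multiplication by `λ` written in a `k`-basis) and every `d ∈ GL₂(𝔽_q)` (it moves each
isotropic vector, a `K`-multiple of a `k`-rational one, inside its `H`-orbit), so every target's grid
`(k^× × μ_{q+1})·z₀` must avoid the L-shaped triples — a condition violated by every random-like pair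
`(Y, Z)` of size `≍ q³` (each grid point is then hit `≍ q⁴` times), i.e. a witness of `stub_subfieldCell`
must keep the Baer sublines of `YY⁻¹ ∖ 1` and of `ZZ⁻¹ ∖ 1` apart.

Sorry-free; axioms `propext`, `Classical.choice`, `Quot.sound`.
-/

set_option linter.dupNamespace false

noncomputable section

open scoped BigOperators

namespace Summit.MatrixMultiplication.MatrixMultiplication.Theorems.GradedDesignFamily.Negative

/-- Re-indexing an `H`-sum by right multiplication with an element of `H`. -/
theorem sum_subgroup_mul_right {G : Type} [Group G] (H : Subgroup G) [Fintype H] (φ : G → ℂ) {h₀ : G} (hh₀ : h₀ ∈ H) :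
    ∑ h : H, φ ((h : G) * h₀) = ∑ h : H, φ (h : G) := by
  refine Fintype.sum_equiv (Equiv.mulRight (⟨h₀, hh₀⟩ : H)) _ _ (fun h => ?_)
  simp [Equiv.coe_mulRight, Subgroup.coe_mul]

/-- **The grid identity.**  If `λ` commutes with `H` and with `d`, `d` normalises `H`, and every point of
`V` is moved by `λ` or by `d` inside its `H`-orbit, then every frame function `g ↦ Σ_u C u (g • u)` has
vanishing alternating sum over the rectangle `Hg, Hλg, Hdg, Hλdg`. -/
theorem sum_frame_grid_eq_zero {G V : Type} [Group G] [MulAction G V] [Fintype V]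
    (H : Subgroup G) [Fintype H] (lam d : G)
    (hlam : ∀ h : G, h ∈ H → lam * h = h * lam) (hld : lam * d = d * lam)
    (hnorm : ∀ h : G, h ∈ H → d * h * d⁻¹ ∈ H)
    (hdich : ∀ v : V, (∃ h ∈ H, h • v = lam • v) ∨ (∃ h ∈ H, h • v = d • v))
    (C : V → V → ℂ) (g : G) :
    ∑ h : H, ((∑ u, C u (((h : G) * g) • u)) - (∑ u, C u (((h : G) * lam * g) • u))
      - (∑ u, C u (((h : G) * d * g) • u)) + (∑ u, C u (((h : G) * lam * d * g) • u))) = 0 := by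
  -- exchange the sums and treat each `u` separately
  have hswap : ∑ h : H, ((∑ u, C u (((h : G) * g) • u)) - (∑ u, C u (((h : G) * lam * g) • u))
      - (∑ u, C u (((h : G) * d * g) • u)) + (∑ u, C u (((h : G) * lam * d * g) • u))) =
      ∑ u, ∑ h : H, (C u (((h : G) * g) • u) - C u (((h : G) * lam * g) • u)
        - C u (((h : G) * d * g) • u) + C u (((h : G) * lam * d * g) • u)) := by
    rw [Finset.sum_comm]
    refine Finset.sum_congr rfl (fun h _ => ?_)
    simp only [Finset.sum_add_distrib, Finset.sum_sub_distrib]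
  rw [hswap]
  refine Finset.sum_eq_zero (fun u _ => ?_)
  have e1 : ∀ h : H, ((h : G) * g) • u = (h : G) • (g • u) := fun h => mul_smul _ _ _
  have e2 : ∀ h : H, ((h : G) * lam * g) • u = (h : G) • (lam • (g • u)) := fun h => by
    rw [mul_smul, mul_smul]
  have e3 : ∀ h : H, ((h : G) * d * g) • u = (h : G) • (d • (g • u)) := fun h => by
    rw [mul_smul, mul_smul]
  have e4 : ∀ h : H, ((h : G) * lam * d * g) • u = (h : G) • (lam • (d • (g • u))) := fun h => by
    rw [mul_smul, mul_smul, mul_smul]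
  simp only [e1, e2, e3, e4]
  generalize g • u = v
  rw [Finset.sum_add_distrib, Finset.sum_sub_distrib, Finset.sum_sub_distrib]
  rcases hdich v with ⟨h₀, hh₀, hh₀v⟩ | ⟨h₁, hh₁, hh₁v⟩
  · -- `λ` moves `v` (and hence `d • v`) inside its `H`-orbit
    have A : ∑ h : H, C u ((h : G) • (lam • v)) = ∑ h : H, C u ((h : G) • v) := by
      have : ∀ h : H, C u ((h : G) • (lam • v)) = C u (((h : G) * h₀) • v) := fun h => by
        rw [← hh₀v]; exact congrArg (C u) (mul_smul _ _ _).symm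
      simp only [this]
      exact sum_subgroup_mul_right H (fun x => C u (x • v)) hh₀
    have B : ∑ h : H, C u ((h : G) • (lam • (d • v))) = ∑ h : H, C u ((h : G) • (d • v)) := by
      have key : lam • (d • v) = (d * h₀ * d⁻¹) • (d • v) :=
        calc lam • (d • v) = (lam * d) • v := (mul_smul _ _ _).symm
          _ = (d * lam) • v := by rw [hld]
          _ = d • (lam • v) := mul_smul _ _ _
          _ = d • (h₀ • v) := by rw [hh₀v]
          _ = (d * h₀) • v := (mul_smul _ _ _).symm
          _ = (d * h₀ * d⁻¹ * d) • v := by congr 1; group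
          _ = (d * h₀ * d⁻¹) • (d • v) := mul_smul _ _ _
      have : ∀ h : H, C u ((h : G) • (lam • (d • v))) = C u (((h : G) * (d * h₀ * d⁻¹)) • (d • v)) :=
        fun h => by rw [key]; exact congrArg (C u) (mul_smul _ _ _).symm
      simp only [this]
      exact sum_subgroup_mul_right H (fun x => C u (x • (d • v))) (hnorm h₀ hh₀)
    rw [A, B]; ring
  · -- `d` moves `v` inside its `H`-orbit
    have A : ∑ h : H, C u ((h : G) • (d • v)) = ∑ h : H, C u ((h : G) • v) := by
      have : ∀ h : H, C u ((h : G) • (d • v)) = C u (((h : G) * h₁) • v) := fun h => by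
        rw [← hh₁v]; exact congrArg (C u) (mul_smul _ _ _).symm
      simp only [this]
      exact sum_subgroup_mul_right H (fun x => C u (x • v)) hh₁
    have B : ∑ h : H, C u ((h : G) • (lam • (d • v))) = ∑ h : H, C u ((h : G) • (lam • v)) := by
      have key : lam • (d • v) = h₁ • (lam • v) :=
        calc lam • (d • v) = lam • (h₁ • v) := by rw [hh₁v]
          _ = (lam * h₁) • v := (mul_smul _ _ _).symm
          _ = (h₁ * lam) • v := by rw [hlam h₁ hh₁]
          _ = h₁ • (lam • v) := mul_smul _ _ _
      have : ∀ h : H, C u ((h : G) • (lam • (d • v))) = C u (((h : G) * h₁) • (lam • v)) :=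
        fun h => by rw [key]; exact congrArg (C u) (mul_smul _ _ _).symm
      simp only [this]
      exact sum_subgroup_mul_right H (fun x => C u (x • (lam • v))) hh₁
    rw [A, B]; ring

/-- **The normalizer-grid law** (route clause).  Let `J ≤ ℂ^G` consist of frame functions
`g ↦ Σ_u C u (g • u)` for an action of `G` on a finite set `V`, let `X` be (the underlying set of) a
finite subgroup `H`, and let `(X, Y, Z)` be `J`-separated in the sense of the route.  If `λ, d` are as in
`sum_frame_grid_eq_zero`, then for no target `z₀ ∈ Z` are the three cosets `Hλz₀`, `Hdz₀`, `Hλdz₀`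
contained in the non-target footprint: some `h λ z₀`, `h d z₀` or `h λ d z₀` (`h ∈ H`) is NOT a word
`x⁻¹ y y'⁻¹ z` with `x ∈ X`, `y, y' ∈ Y`, `z ∈ Z`, `¬(x = 1 ∧ y = y' ∧ z = z₀)`. -/
theorem not_frameSeparated_of_grid_triple {G V : Type} [Group G] [MulAction G V] [Fintype V]
    [DecidableEq G] (H : Subgroup G) [Fintype H]
    (J : Submodule ℂ (G → ℂ)) (hJ : ∀ f ∈ J, ∃ C : V → V → ℂ, f = fun g => ∑ u, C u (g • u))
    (lam d : G)
    (hlam : ∀ h : G, h ∈ H → lam * h = h * lam) (hld : lam * d = d * lam)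
    (hnorm : ∀ h : G, h ∈ H → d * h * d⁻¹ ∈ H)
    (hdich : ∀ v : V, (∃ h ∈ H, h • v = lam • v) ∨ (∃ h ∈ H, h • v = d • v))
    (X Y Z : Finset G) (hX : ∀ x : G, x ∈ X ↔ x ∈ H)
    (hsep : ∀ x₀ ∈ X, ∀ z₀ ∈ Z, ∃ f ∈ J, ∀ x ∈ X, ∀ y ∈ Y, ∀ y' ∈ Y, ∀ z ∈ Z,
      (x = x₀ ∧ y = y' ∧ z = z₀ → f (x⁻¹ * y * y'⁻¹ * z) = 1) ∧
      (¬ (x = x₀ ∧ y = y' ∧ z = z₀) → f (x⁻¹ * y * y'⁻¹ * z) = 0))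
    (z₀ : G) (hz₀ : z₀ ∈ Z)
    (hfoot : ∀ w : G, (w = lam ∨ w = d ∨ w = lam * d) → ∀ h : G, h ∈ H →
      ∃ x ∈ X, ∃ y ∈ Y, ∃ y' ∈ Y, ∃ z ∈ Z,
        ¬ (x = 1 ∧ y = y' ∧ z = z₀) ∧ h * w * z₀ = x⁻¹ * y * y'⁻¹ * z) :
    False := by
  classical
  have h1X : (1 : G) ∈ X := (hX 1).2 H.one_mem
  obtain ⟨f, hfJ, hf⟩ := hsep 1 h1X z₀ hz₀
  obtain ⟨C, rfl⟩ := hJ f hfJ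
  -- `Y` is non-empty (the footprint hypothesis produces an element)
  obtain ⟨_, _, y₁, hy₁, -⟩ := hfoot lam (Or.inl rfl) 1 H.one_mem
  -- the grid identity at `g = z₀`
  have hgrid := sum_frame_grid_eq_zero H lam d hlam hld hnorm hdich C z₀
  -- value on the target coset: `[h = 1]`
  have htarget : ∀ h : H, (∑ u, C u (((h : G) * z₀) • u)) = if (h : G) = 1 then 1 else 0 := by
    intro h
    have hxX : ((h : G)⁻¹) ∈ X := (hX _).2 (H.inv_mem h.2)
    obtain ⟨hone, hzero⟩ := hf ((h : G)⁻¹) hxX y₁ hy₁ y₁ hy₁ z₀ hz₀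
    have hw : ((h : G)⁻¹)⁻¹ * y₁ * y₁⁻¹ * z₀ = (h : G) * z₀ := by group
    rw [hw] at hone hzero
    split_ifs with hh
    · exact hone ⟨inv_eq_one.2 hh, rfl, rfl⟩
    · exact hzero (fun hc => hh (inv_eq_one.1 hc.1))
  -- value on the three garbage cosets: `0`
  have hgarb : ∀ w : G, (w = lam ∨ w = d ∨ w = lam * d) → ∀ h : H,
      (∑ u, C u (((h : G) * w * z₀) • u)) = 0 := by
    intro w hw h
    obtain ⟨x, hx, y, hy, y', hy', z, hz, hnd, heq⟩ := hfoot w hw h h.2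
    obtain ⟨-, hzero⟩ := hf x hx y hy y' hy' z hz
    have := hzero hnd
    rwa [← heq] at this
  have hsum1 : ∑ h : H, (∑ u, C u (((h : G) * z₀) • u)) = 1 := by
    simp only [htarget, OneMemClass.coe_eq_one, Finset.sum_ite_eq', Finset.mem_univ, if_true]
  have hsum : ∑ h : H, ((∑ u, C u (((h : G) * z₀) • u)) - (∑ u, C u (((h : G) * lam * z₀) • u))
      - (∑ u, C u (((h : G) * d * z₀) • u)) + (∑ u, C u (((h : G) * lam * d * z₀) • u))) = 1 := by
    have e : ∀ h : H, ((∑ u, C u (((h : G) * z₀) • u)) - (∑ u, C u (((h : G) * lam * z₀) • u))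
        - (∑ u, C u (((h : G) * d * z₀) • u)) + (∑ u, C u (((h : G) * lam * d * z₀) • u))) =
        (∑ u, C u (((h : G) * z₀) • u)) := by
      intro h
      rw [hgarb lam (Or.inl rfl) h, hgarb d (Or.inr (Or.inl rfl)) h]
      have := hgarb (lam * d) (Or.inr (Or.inr rfl)) h
      rw [← mul_assoc] at this
      rw [this]; ring
    simp only [e]
    exact hsum1
  rw [hgrid] at hsum
  exact zero_ne_one hsum

end Summit.MatrixMultiplication.MatrixMultiplication.Theorems.GradedDesignFamily.Negative

end
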